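import Summits.AtomisticToContinuum.HydrodynamicLimit.Theorems.OneFlightGossipEngineCollisionActivityTailsAbnormalActivityTaggedMajorant
import HarnessLib

/-!
# `CollisionActivityTails` (stmt-AtomisticToContinuum-13734), line `plaque-thinning-count-ld`, stub 5, TAGGED half — file 6/6:
the pathwise bound and the assembly; `stub_taggedFromLabelEnvelope` PROVED

Helper file (`--supports stmt-AtomisticToContinuum-13734`) of the crux
`Summit.AtomisticToContinuum.HydrodynamicLimit.Theses.OneFlightGossipEngine.CollisionActivityTails`, line `plaque-thinning-count-ld`,
stub 5 (abnormal activity), TAGGED half `stub_taggedFromLabelEnvelope : LabelEnvelopeFromEnvelope → TaggedFromEnvelope`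
(file `…AbnormalActivityTagged`): under the true local Gibbs law the tagged cold window activity (collisions of particles sitting in an
over-dense or over-heated ball at some scale `≥ K`) is small in mean, from a label-set law envelope of the laws at the times of the
window. Vocabulary: `Tagged`, `tagAct`, `TaggedSmallOn`, `TaggedFromEnvelope`, `imp_le_relSpeed` of `…AbnormalActivity(Hot)` (w-abnormal),
`LabelLawEnvelope`, `LabelEnvelopeOn`, `LabelEnvelopeFromEnvelope` of `…EnvelopePlumbing` (lead), `windowEvent`, `pairTubeSet` of
`…AbnormalActivityStatics`.

This file: §9 on the good set the normalised tagged cold activity of the window `(s, s+w]` is at most `(N+1)⁻¹(σ/τ) ×` the collision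
sum of the tagged mark `𝟙{Tagged} |v_k - v_l|` over `[s, s+w]` (`ofReal_sum_tagAct_le`; `|Δv_k| ≤ |v_k - v_l|`, `imp_le_relSpeed`); §10 the
assembly `taggedSmallOn_of_labelEnvelopeOn`: threshold `y₀ = 200 A max(1, β⁻¹)` (`y₀σ³ ≤ 1` is the diluteness clause with `κ₅ = 1/200`,
`y₀ > 0` by total mass), minimal scale `K` with `44 σ³ C² J 2^{-K} ≤ η`, `N₀(τ)` with `w_N < t₁ - t` (`eventually_window_lt`), speed cap
`U(N)` and mesh threshold `M₀`, the NON-STATIONARY one-window flux inequality `exists_measurable_majorant_collisionSum_of_forall_le`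
with events cut from swept tubes (`exists_sweptTube`), the majorant `tagMajor`, and the per-pair static bounds under the laws at the
grid times — mean `≤ (N+1)⁻¹(σ/τ)(N+1)² · 11 · 2^{-K} C² 4ε²w_N J = 44 σ³ C² J 2^{-K} ≤ η` (`hsDiameter_sq_mul_window`) uniformly in `τ`;
and `stub_taggedFromLabelEnvelope : LabelEnvelopeFromEnvelope → TaggedFromEnvelope` (`κ₅ = 1/200`, `σ₅ = 1/2`).

References: C. Cercignani, R. Illner, M. Pulvirenti, *The Mathematical Theory of Dilute Gases* (1994), §4.3, App. 4.A (collision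
cylinders, collision sums along the hard-sphere flow); I. Gallagher, L. Saint-Raymond, B. Texier, *From Newton to Boltzmann* (2013),
Ch. 4. Elementary measure theory and bookkeeping; recorded here.
-/

noncomputable section

open MeasureTheory Set Filter Topology
open scoped ENNReal

namespace Summit.AtomisticToContinuum.HydrodynamicLimit.Theorems.CollisionActivityTailsAbnormalActivityTagged

open Literature.MathematicalPhysics.KineticTheory Literature.Analysis.FluidPDE
open Summit.AtomisticToContinuum.HydrodynamicLimit.Theorems.CollisionActivityTailsActivityDomination
  (Flow Cfg window act tdist nearCount collisionPairSum_nonneg window_pos)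
open Summit.AtomisticToContinuum.HydrodynamicLimit.Theorems.CollisionActivityTailsAbnormalActivityStatics
open Summit.AtomisticToContinuum.HydrodynamicLimit.Theorems.CollisionActivityTailsCrowdedActivityMeasurable
  (measurable_tdist_config natCast_nearCount)
open Summit.AtomisticToContinuum.HydrodynamicLimit.Theorems.CollisionActivityTailsEndpointTails (ae_mem_good_localGibbsLaw)
-- the tagging vocabulary and the two statements of the tagged half (w-abnormal's reduction file, landed):
open Summit.AtomisticToContinuum.HydrodynamicLimit.Theorems.CollisionActivityTailsAbnormalActivity
  (rec imp relSpeed scaleRadius ballKinetic Tagged tagAct TaggedSmallOn TaggedFromEnvelope imp_le_relSpeed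
    hsDiameter_sq_mul_window eventually_window_lt)
-- σ-finiteness of the phase spaces (named instances, landed):
open Summit.AtomisticToContinuum.HydrodynamicLimit.Theorems.MacroBookkeeping (sigmaFinite_volume_phase sigmaFinite_volume_config)
-- the label-set envelope vocabulary (the lead's plumbing, landed with `stub_labelEnvelopeOn`):
open Summit.AtomisticToContinuum.HydrodynamicLimit.Theorems.CollisionActivityTailsEnvelopePlumbing
  (gaussTupleWeight LabelLawEnvelope LabelEnvelopeOn LabelEnvelopeFromEnvelope)

/-! ## §9 The tagged cold activity as a window collision sum of the tagged mark -/

section Pathwise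

variable {σ : ℝ} {N : ℕ}

open scoped Classical in
/-- The tagged cold summand of one particle is dominated by the tagged mark:
`ofReal (𝟙{k = i, |g| ≤ Θ, Tagged} |Δv_k|) ≤ 𝟙{k = i} tagMark`. -/
theorem ofReal_tagSummand_le (Θ y : ℝ) (K : ℕ) (w : Cfg N) (t : ℝ) (i k l : Fin (N + 1)) :
    ENNReal.ofReal (if k = i ∧ relSpeed w k l ≤ Θ ∧ Tagged y K w i then imp σ N w t k l else 0) ≤
      if k = i then tagMark y K w k l else 0 := by
  by_cases hk : k = i
  · subst hk
    rw [if_pos rfl]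
    unfold tagMark
    by_cases hT : Tagged y K w k
    · rw [if_pos hT]
      split_ifs
      · exact ENNReal.ofReal_le_ofReal (imp_le_relSpeed w t k l)
      · simp
    · rw [if_neg hT, if_neg (fun h => hT h.2.2), ENNReal.ofReal_zero]
  · rw [if_neg (fun h => hk h.1), if_neg hk, ENNReal.ofReal_zero]

/-- **The normalised tagged cold activity is dominated by a window collision sum of the tagged mark.** On the good set,
`ofReal((N+1)⁻¹ Σ_i tagAct_i z) ≤ ofReal((N+1)⁻¹ σ/τ) · Σ_{collision times r ∈ [s, s+w]} Σ_{k ≠ l in contact} tagMark y K (Φ_r z) k l`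
(`τ ≥ 0`, `σ ≥ 0`; each collision of `i` is the ordered contact pair `(i, partner)`, `Σ_i 𝟙{k = i} = 1`, `|Δv_k| ≤ |v_k - v_l|`,
`(s, s+w] ⊆ [s, s+w]`). (Adapted from `ofReal_sum_hotAct_le`, `…AbnormalActivityHot`.) -/
theorem ofReal_sum_tagAct_le (hσ : 0 ≤ σ) (Θ y : ℝ) (K : ℕ) (Φ : Flow σ N) {τ : ℝ} (hτ : 0 ≤ τ) (s : ℝ) {z : Cfg N}
    (hz : z ∈ Φ.good) :
    ENNReal.ofReal (((N : ℝ) + 1)⁻¹ * ∑ i : Fin (N + 1), tagAct Θ y K Φ τ s i z) ≤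
      ENNReal.ofReal (((N : ℝ) + 1)⁻¹ * (σ / τ)) *
        ∑ᶠ r ∈ collisionTimes (Torus.geometry (Fin 3)) (hsDiameter σ N) (fun t => Φ.flow t z) ∩
            Icc s (s + window τ N),
          ∑ k : Fin (N + 1), ∑ l : Fin (N + 1),
            (if k ≠ l ∧ ‖(Torus.geometry (Fin 3)).sepVec (Φ.flow r z k).1 (Φ.flow r z l).1‖ = hsDiameter σ N
              then tagMark y K (Φ.flow r z) k l else 0) := by
  classical
  set G := Torus.geometry (Fin 3)
  set ε := hsDiameter σ N
  have hfinI : (collisionTimes G ε (fun t => Φ.flow t z) ∩ Ioc s (s + window τ N)).Finite :=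
    Φ.finite_collisionTimes_inter hz Ioc_subset_Icc_self
  have hfinC : (collisionTimes G ε (fun t => Φ.flow t z) ∩ Icc s (s + window τ N)).Finite :=
    Φ.finite_collisionTimes_inter hz Subset.rfl
  have hc : 0 ≤ ((N : ℝ) + 1)⁻¹ * (σ / τ) := mul_nonneg (inv_nonneg.2 (by positivity)) (div_nonneg hσ hτ)
  -- Step 1: pull out the constants and pass `ofReal` inside the finite sums of nonnegative terms
  have hsum : ∑ i : Fin (N + 1), tagAct Θ y K Φ τ s i z = σ / τ * ∑ i : Fin (N + 1),
      Φ.collisionPairSum (Ioc s (s + window τ N))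
        (fun t cfg k l => if k = i ∧ relSpeed cfg k l ≤ Θ ∧ Tagged y K cfg i then imp σ N cfg t k l else 0) z := by
    unfold tagAct; rw [Finset.mul_sum]
  have hnn : ∀ (i : Fin (N + 1)) t (cfg : Cfg N) k l,
      0 ≤ (if k = i ∧ relSpeed cfg k l ≤ Θ ∧ Tagged y K cfg i then imp σ N cfg t k l else 0) := by
    intro i t cfg k l; split_ifs; exacts [norm_nonneg _, le_rfl]
  rw [hsum, ← mul_assoc, ENNReal.ofReal_mul hc]
  gcongr
  -- Step 2: each particle's tagged sum, in `ℝ≥0∞`, is at most the collision pair sum of `𝟙{k = i} tagMark` over `[s, s+w]`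
  rw [ENNReal.ofReal_sum_of_nonneg fun i _ => collisionPairSum_nonneg Φ _ (hnn i) z]
  have hstep : ∀ i : Fin (N + 1), ENNReal.ofReal (Φ.collisionPairSum (Ioc s (s + window τ N))
      (fun t cfg k l => if k = i ∧ relSpeed cfg k l ≤ Θ ∧ Tagged y K cfg i then imp σ N cfg t k l else 0) z) ≤
      ∑ r ∈ hfinC.toFinset, ∑ p ∈ contactPairs G ε (Φ.flow r z),
        (if p.1 = i then tagMark y K (Φ.flow r z) p.1 p.2 else 0) := by
    intro i
    unfold HardSphereFlow.collisionPairSum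
    rw [collisionPairSum_eq_finset_sum hfinI,
      ENNReal.ofReal_sum_of_nonneg fun r _ => Finset.sum_nonneg fun p _ => hnn i _ _ _ _]
    calc ∑ r ∈ hfinI.toFinset, ENNReal.ofReal (∑ p ∈ contactPairs G ε (Φ.flow r z),
            (if p.1 = i ∧ relSpeed (Φ.flow r z) p.1 p.2 ≤ Θ ∧ Tagged y K (Φ.flow r z) i
              then imp σ N (Φ.flow r z) r p.1 p.2 else 0))
        = ∑ r ∈ hfinI.toFinset, ∑ p ∈ contactPairs G ε (Φ.flow r z), ENNReal.ofReal
            (if p.1 = i ∧ relSpeed (Φ.flow r z) p.1 p.2 ≤ Θ ∧ Tagged y K (Φ.flow r z) i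
              then imp σ N (Φ.flow r z) r p.1 p.2 else 0) :=
          Finset.sum_congr rfl fun r _ => ENNReal.ofReal_sum_of_nonneg fun p _ => hnn i _ _ _ _
      _ ≤ ∑ r ∈ hfinI.toFinset, ∑ p ∈ contactPairs G ε (Φ.flow r z),
            (if p.1 = i then tagMark y K (Φ.flow r z) p.1 p.2 else 0) :=
          Finset.sum_le_sum fun r _ => Finset.sum_le_sum fun p _ => ofReal_tagSummand_le Θ y K _ r i p.1 p.2
      _ ≤ _ := by
          refine Finset.sum_le_sum_of_subset_of_nonneg (fun r hr => ?_) fun _ _ _ => bot_le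
          rw [Set.Finite.mem_toFinset] at hr ⊢
          exact ⟨hr.1, Ioc_subset_Icc_self hr.2⟩
  refine (Finset.sum_le_sum fun i _ => hstep i).trans (le_of_eq ?_)
  -- Step 3: swap the sums; `Σ_i 𝟙{k = i} = 1`; the inline form of the pair sum on the good set
  rw [Finset.sum_comm, finsum_mem_eq_finite_toFinset_sum _ hfinC]
  refine Finset.sum_congr rfl fun r _ => ?_
  rw [Finset.sum_comm]
  simp only [Finset.sum_ite_eq, Finset.mem_univ, if_true]
  exact sum_contactPairs_eq ((Φ.isTrajectory z hz).mem r) fun k l => tagMark y K (Φ.flow r z) k l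

end Pathwise

/-! ## §10 Assembly: the tagged half from a label-set envelope on the horizon -/

section Assembly

variable {σ : ℝ}

/-- **Choice of the speed cap**: `F e^{-λU²} ≤ b` for some `U ≥ 0` (`F < ∞`, `b > 0`). -/
theorem exists_speedCap {β : ℝ} (hβ : 0 < β) {F : ℝ≥0∞} (hF : F ≠ ⊤) {b : ℝ≥0∞} (hb : 0 < b) :
    ∃ U : ℝ, 0 ≤ U ∧ F * ENNReal.ofReal (Real.exp (-(β / 4 * U ^ 2))) ≤ b := by
  have h1 : Tendsto (fun n : ℕ => -(β / 4 * (n : ℝ) ^ 2)) atTop atBot := by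
    have h : Tendsto (fun n : ℕ => (n : ℝ) ^ 2) atTop atTop := (tendsto_pow_atTop two_ne_zero).comp tendsto_natCast_atTop_atTop
    exact tendsto_neg_atTop_atBot.comp (h.const_mul_atTop (by positivity))
  have h2 : Tendsto (fun n : ℕ => ENNReal.ofReal (Real.exp (-(β / 4 * (n : ℝ) ^ 2)))) atTop (𝓝 0) := by
    rw [← ENNReal.ofReal_zero]
    exact ENNReal.tendsto_ofReal (Real.tendsto_exp_atBot.comp h1)
  have h3 := ENNReal.Tendsto.const_mul h2 (Or.inr hF)
  rw [mul_zero] at h3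
  obtain ⟨n, hn⟩ := (h3.eventually (gt_mem_nhds hb)).exists
  exact ⟨n, n.cast_nonneg, hn.le⟩

/-- **Choice of the minimal scale**: `Z 2^{-K} ≤ b` for some `K ≥ 1` (`Z < ∞`, `b > 0`). -/
theorem exists_scaleK {Z : ℝ≥0∞} (hZ : Z ≠ ⊤) {b : ℝ≥0∞} (hb : 0 < b) : ∃ K : ℕ, 1 ≤ K ∧ Z * 2⁻¹ ^ K ≤ b := by
  have h1 : Tendsto (fun K : ℕ => (2⁻¹ : ℝ≥0∞) ^ K) atTop (𝓝 0) :=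
    ENNReal.tendsto_pow_atTop_nhds_zero_of_lt_one (ENNReal.inv_lt_one.2 ENNReal.one_lt_two)
  have h2 := ENNReal.Tendsto.const_mul h1 (Or.inr hZ)
  rw [mul_zero] at h2
  obtain ⟨K, hK⟩ := ((h2.eventually (gt_mem_nhds hb)).and (eventually_ge_atTop 1)).exists
  exact ⟨K, hK.2, hK.1.le⟩

/-- **THE TAGGED HALF FROM A LABEL-SET ENVELOPE** (dynamics and bookkeeping): for `0 < σ ≤ 1/2`, continuous positive profiles,
`0 ≤ t < t₁`, `β > 0`, `C ≥ 0` with the diluteness clause `C (2π/β)^{3/2} σ³ max(1, β⁻¹) ≤ 1/200`, a label-set envelope on `[0, t₁]`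
gives `TaggedSmallOn` on the horizon `t`, with threshold `y₀ = 200 A max(1, β⁻¹)`, `A = C (2π/β)^{3/2} ≥ 1` (total mass). Given
`y ≥ y₀`, `Θ`, `η`: the minimal scale `K` with `44 σ³ C² J 2^{-K} ≤ η`; given `τ`: `N₀(τ)` with `w_N < t₁ - t`; for `N ≥ N₀`, `s ≤ t`:
a speed cap `U` with `(N+1)(1 + C c') e^{-βU²/4} ≤ 2^{-K}`, a mesh threshold `M₀` with `2 U w_N / M₀ ≤ R_1`, the window inequality
on `[s, s + w_N]` with the tagged mark, events cut from swept tubes of mesh `w_N/M` and the majorant `tagMajor` (enlarged tag at the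
grid time), and the static per-pair bounds `11 · 2^{-K} C² · 4ε²(w_N/M) J` under the laws at the times of the window (label-set
envelope) — mean `≤ (N+1)⁻¹ (σ/τ) (N+1)² · 11 · 2^{-K} C² · 4 ε² w_N J = 44 σ³ C² J 2^{-K} ≤ η`, uniformly in `τ`. -/
theorem taggedSmallOn_of_labelEnvelopeOn (hσ : 0 < σ) (hσ2 : σ ≤ 1 / 2) {a₀ θ₀ : T3 → ℝ} {u₀ : T3 → V3}
    (ha : Continuous a₀) (hθ : Continuous θ₀) (hu : Continuous u₀) (ha0 : ∀ x, 0 < a₀ x) (hθ0 : ∀ x, 0 < θ₀ x)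
    {Φ : (N : ℕ) → Flow σ N} {t t₁ β C : ℝ} (ht : 0 ≤ t) (htt₁ : t < t₁) (hβ : 0 < β) (hC : 0 ≤ C)
    (hdil : C * (2 * Real.pi / β) ^ (3 / 2 : ℝ) * σ ^ 3 * max 1 β⁻¹ ≤ 1 / 200)
    (hLE : LabelEnvelopeOn σ a₀ θ₀ u₀ Φ t₁ β C) : TaggedSmallOn σ a₀ θ₀ u₀ Φ t := by
  classical
  set A : ℝ := C * (2 * Real.pi / β) ^ (3 / 2 : ℝ) with hAdef
  -- total mass: `1 ≤ A`
  have hA : 1 ≤ A := by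
    haveI := isProbabilityMeasure_localGibbsLaw ha hθ hu ha0 hθ0 hσ2 0 (Φ 0)
    haveI : IsProbabilityMeasure ((localGibbsLaw σ a₀ u₀ θ₀ 0 (Φ 0)).map ((Φ 0).flow 0)) :=
      Measure.isProbabilityMeasure_map ((Φ 0).measurable_flow 0).aemeasurable
    exact one_le_envelopeConst hC hβ (hLE 0 0 ⟨le_rfl, by linarith⟩)
  have hA0 : 0 < A := one_pos.trans_le hA
  refine ⟨200 * A * max 1 β⁻¹, by positivity, ?_, fun y hy Θ _ η hη => ?_⟩
  · -- the dense-phase range `y₀ σ³ ≤ 1` is the diluteness clause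
    calc 200 * A * max 1 β⁻¹ * σ ^ 3 = 200 * (C * (2 * Real.pi / β) ^ (3 / 2 : ℝ) * σ ^ 3 * max 1 β⁻¹) := by
          rw [hAdef]; ring
      _ ≤ 200 * (1 / 200) := by gcongr
      _ = 1 := by norm_num
  -- the minimal scale `K`: `44 σ³ C² J 2^{-K} ≤ η`
  set Z : ℝ≥0∞ := ENNReal.ofReal (4 * σ ^ 3) * (11 * (ENNReal.ofReal (C ^ 2) * fluxJ β)) with hZ
  have hZtop : Z ≠ ⊤ := ENNReal.mul_ne_top ENNReal.ofReal_ne_top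
    (ENNReal.mul_ne_top (by norm_num) (ENNReal.mul_ne_top ENNReal.ofReal_ne_top (fluxJ_lt_top hβ).ne))
  obtain ⟨K, hK1, hK⟩ := exists_scaleK hZtop (ENNReal.ofReal_pos.2 hη)
  refine ⟨K, fun τ hτ => ?_⟩
  obtain ⟨N₀, hN₀⟩ := eventually_window_lt (τ := τ) (t₁ - t) (by linarith)
  refine ⟨N₀, fun N hN s hs => ?_⟩
  set w : ℝ := window τ N with hwdef
  have hw : 0 < w := window_pos hτ N
  have hwt : w < t₁ - t := hN₀ N hN
  set ε : ℝ := hsDiameter σ N with hεdef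
  have hε : 0 < ε := hsDiameter_pos hσ N
  set P : Measure (Cfg N) := localGibbsLaw σ a₀ u₀ θ₀ N (Φ N) with hP
  -- the speed cap `U` and the mesh threshold `M₀`
  set c' : ℝ≥0∞ := ENNReal.ofReal ((2 * Real.pi / (β / 2)) ^ (3 / 2 : ℝ)) with hc'
  have hFtop : ((N : ℝ≥0∞) + 1) * (1 + ENNReal.ofReal C * c') ≠ ⊤ :=
    ENNReal.mul_ne_top (ENNReal.add_ne_top.2 ⟨ENNReal.natCast_ne_top N, ENNReal.one_ne_top⟩)
      (ENNReal.add_ne_top.2 ⟨ENNReal.one_ne_top, ENNReal.mul_ne_top ENNReal.ofReal_ne_top ENNReal.ofReal_ne_top⟩)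
  have h2pos : (0 : ℝ≥0∞) < 2⁻¹ ^ K := ENNReal.pow_pos (ENNReal.inv_pos.2 ENNReal.ofNat_ne_top) K
  obtain ⟨U, hU, hUcap⟩ := exists_speedCap hβ hFtop h2pos
  have hR1 : 0 < scaleRadius N 1 := scaleRadius_pos N le_rfl
  obtain ⟨M₀, hM₀⟩ := exists_nat_gt (2 * U * w / scaleRadius N 1)
  have hδM : ∀ M : ℕ, M₀ ≤ M → 2 * U * (w / M) ≤ scaleRadius N 1 := by
    intro M hM
    have hM₀pos : (0 : ℝ) < M₀ := lt_of_le_of_lt (by positivity) hM₀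
    have hMM : (M₀ : ℝ) ≤ M := by exact_mod_cast hM
    have hM0 : (0 : ℝ) < M := by linarith
    rw [div_lt_iff₀ hR1] at hM₀
    rw [show 2 * U * (w / M) = 2 * U * w / M by ring, div_le_iff₀ hM0]
    nlinarith
  -- swept tubes of mesh `w / M` and the window events cut from them
  have htube : ∀ M : ℕ, ∃ S : V3 → Set V3, MeasurableSet {q : V3 × V3 | q.1 ∈ S q.2} ∧
      (∀ u, volume (S u) ≤ ENNReal.ofReal (4 * ε ^ 2 * (w / M) * ‖u‖)) ∧
      ∀ (u r : V3) (s : ℝ), ε ≤ ‖r‖ → s ∈ Icc 0 (w / M) → ‖r + s • u‖ = ε → r ∈ S u :=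
    fun M => exists_sweptTube hε (div_nonneg hw.le (Nat.cast_nonneg M))
  choose S hSm hSvol hS using htube
  set E : ℕ → Fin (N + 1) → Fin (N + 1) → Set (Cfg N) := fun M k l => windowEvent (S M) k l with hE
  set n : ℝ≥0∞ := ((N + 1 : ℕ) : ℝ≥0∞) with hn
  set Q : ℕ → ℝ≥0∞ := fun M => ENNReal.ofReal (C ^ 2) * (ENNReal.ofReal (4 * ε ^ 2 * (w / M)) * fluxJ β) with hQ
  set B : ℕ → ℝ≥0∞ := fun M => if M₀ ≤ M then n * n * (11 * 2⁻¹ ^ K * Q M) else ⊤ with hB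
  -- the static one-window bounds under the laws at the times of the window
  have hBle : ∀ (M : ℕ), ∀ r ∈ Icc s (s + w),
      ∫⁻ x, ∑ k : Fin (N + 1), ∑ l : Fin (N + 1),
        (if k ≠ l then (E M k l).indicator (fun x => tagMajor y (2 * U * (w / M)) U K x k l) x else 0)
          ∂(P.map ((Φ N).flow r)) ≤ B M := by
    intro M r hr
    by_cases hM : M₀ ≤ M
    swap
    · simp only [hB, if_neg hM]; exact le_top
    simp only [hB, if_pos hM]
    have hr' : r ∈ Icc 0 t₁ := ⟨hs.1.trans hr.1, by linarith [hr.2, hs.2]⟩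
    have hLL := hLE N r hr'
    have hεh : 0 ≤ 4 * ε ^ 2 * (w / M) := by positivity
    have hterm : ∀ k l : Fin (N + 1),
        ∫⁻ x, (if k ≠ l then (E M k l).indicator (fun x => tagMajor y (2 * U * (w / M)) U K x k l) x else 0)
          ∂(P.map ((Φ N).flow r)) ≤ 11 * 2⁻¹ ^ K * Q M := by
      intro k l
      by_cases hkl : k ≠ l
      · simp only [if_pos hkl]
        have hind : ∀ x : Cfg N, (E M k l).indicator (fun x => tagMajor y (2 * U * (w / M)) U K x k l) x =
            tubePair (S M) (x k) (x l) *
              ((if ∃ j, U < ‖(x j).2‖ then 1 else 0) + (if TaggedPlus y (2 * U * (w / M)) K x k then 1 else 0)) :=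
          fun x => indicator_windowEvent_eq_tubePair (S M) k l x _
        simp_rw [hind]
        exact lintegral_tubePair_tagMajor_le hC hβ hLL hkl (hSm M) hεh (hSvol M) hA hy hK1 (by positivity) (hδM M hM) hU hUcap
      · simp only [if_neg hkl, lintegral_const, zero_mul, zero_le]
    have hmeas : ∀ k l : Fin (N + 1), Measurable fun x : Cfg N =>
        (if k ≠ l then (E M k l).indicator (fun x => tagMajor y (2 * U * (w / M)) U K x k l) x else 0) := by
      intro k l
      by_cases hkl : k ≠ l
      · simp only [if_pos hkl]
        exact (measurable_tagMajor _ _ _ _ k l).indicator (measurableSet_windowEvent (hSm M) k l)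
      · simp only [if_neg hkl]; exact measurable_const
    calc _ = ∑ k : Fin (N + 1), ∑ l : Fin (N + 1),
          ∫⁻ x, (if k ≠ l then (E M k l).indicator (fun x => tagMajor y (2 * U * (w / M)) U K x k l) x else 0)
            ∂(P.map ((Φ N).flow r)) := by
          rw [lintegral_finsetSum _ fun k _ => Finset.measurable_sum _ fun l _ => hmeas k l]
          exact Finset.sum_congr rfl fun k _ => lintegral_finsetSum _ fun l _ => hmeas k l
      _ ≤ ∑ _k : Fin (N + 1), ∑ _l : Fin (N + 1), 11 * 2⁻¹ ^ K * Q M :=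
          Finset.sum_le_sum fun k _ => Finset.sum_le_sum fun l _ => hterm k l
      _ = n * n * (11 * 2⁻¹ ^ K * Q M) := by
          simp only [Finset.sum_const, Finset.card_univ, Fintype.card_fin, nsmul_eq_mul, hn]; ring
  -- the window inequality: a measurable majorant of the tagged-mark collision sum over `[s, s + w]`
  obtain ⟨g, hgm, hdom, hint⟩ := exists_measurable_majorant_collisionSum_of_forall_le (Φ N) P hw s
    (fun x k l => tagMark y K x k l) E (fun M k l => measurableSet_windowEvent (hSm M) k l)
    (fun M k l hkl x hx t' ht' hc => mem_windowEvent_of_contact (hS M) hkl hx ht' hc)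
    (fun M x k l => tagMajor y (2 * U * (w / M)) U K x k l) (fun M k l => measurable_tagMajor _ _ _ _ k l)
    (fun M k l _ x _ t' ht' _ => tagMark_freeFlight_le ht'.1 (mul_le_mul_of_nonneg_left ht'.2 (by positivity)) x k l) B hBle
  -- `liminf_M M · B M ≤ (N+1)² · 11 · 2^{-K} C² · 4 ε² w · J`
  set L : ℝ≥0∞ := n * n * (11 * 2⁻¹ ^ K * (ENNReal.ofReal (C ^ 2) * (ENNReal.ofReal (4 * ε ^ 2 * w) * fluxJ β))) with hL
  have hMB : ∀ M : ℕ, max M₀ 1 ≤ M → (M : ℝ≥0∞) * B M = L := by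
    intro M hM
    have hM0' : M₀ ≤ M := le_of_max_le_left hM
    have hkey : (M : ℝ≥0∞) * ENNReal.ofReal (4 * ε ^ 2 * (w / M)) = ENNReal.ofReal (4 * ε ^ 2 * w) := by
      have hM1 : (0 : ℝ) < M := by exact_mod_cast (le_of_max_le_right hM)
      rw [← ENNReal.ofReal_natCast, ← ENNReal.ofReal_mul (Nat.cast_nonneg M)]
      congr 1; field_simp
    simp only [hB, if_pos hM0', hQ, hL]
    rw [← hkey]; ring
  have hlim : liminf (fun M : ℕ => (M : ℝ≥0∞) * B M) atTop ≤ L :=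
    liminf_le_of_frequently_le' (((eventually_ge_atTop (max M₀ 1)).mono fun M hM => (hMB M hM).le).frequently)
  -- the constants: `(N+1)⁻¹ (σ/τ) · (N+1)² · 4 ε² w = 4 σ³`
  set c₁ : ℝ≥0∞ := ENNReal.ofReal (((N : ℝ) + 1)⁻¹ * (σ / τ)) with hc₁
  have hconst : c₁ * L = Z * 2⁻¹ ^ K := by
    have hn' : n = ENNReal.ofReal ((N : ℝ) + 1) := by
      rw [hn, ← ENNReal.ofReal_natCast]; push_cast; rfl
    have h1 : 0 ≤ ((N : ℝ) + 1)⁻¹ * (σ / τ) := by positivity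
    have hreal : ((N : ℝ) + 1)⁻¹ * (σ / τ) * ((N : ℝ) + 1) * ((N : ℝ) + 1) * (4 * ε ^ 2 * w) = 4 * σ ^ 3 := by
      have hsc : ε ^ 2 * w = σ ^ 2 * τ * ((N : ℝ) + 1)⁻¹ := hsDiameter_sq_mul_window σ τ N
      have hN1 : (N : ℝ) + 1 ≠ 0 := by positivity
      calc ((N : ℝ) + 1)⁻¹ * (σ / τ) * ((N : ℝ) + 1) * ((N : ℝ) + 1) * (4 * ε ^ 2 * w)
          = 4 * (σ / τ) * (((N : ℝ) + 1)⁻¹ * ((N : ℝ) + 1)) * ((N : ℝ) + 1) * (ε ^ 2 * w) := by ring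
        _ = 4 * σ ^ 3 := by rw [hsc, inv_mul_cancel₀ hN1]; field_simp
    have h4 : c₁ * n * n * ENNReal.ofReal (4 * ε ^ 2 * w) = ENNReal.ofReal (4 * σ ^ 3) := by
      rw [hc₁, hn', ← ENNReal.ofReal_mul h1, ← ENNReal.ofReal_mul (by positivity), ← ENNReal.ofReal_mul (by positivity),
        hreal]
    calc c₁ * L = c₁ * n * n * ENNReal.ofReal (4 * ε ^ 2 * w) * (11 * 2⁻¹ ^ K * (ENNReal.ofReal (C ^ 2) * fluxJ β)) := by
          rw [hL]; ring
      _ = Z * 2⁻¹ ^ K := by rw [h4, hZ]; ring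
  -- conclude: pathwise domination a.e. (the law is carried by the good set), the mean of the majorant, the constants
  calc ∫⁻ z, ENNReal.ofReal (((N : ℝ) + 1)⁻¹ * ∑ i : Fin (N + 1), tagAct Θ y K (Φ N) τ s i z) ∂P
      ≤ ∫⁻ z, c₁ * g z ∂P := by
        refine lintegral_mono_ae ?_
        filter_upwards [ae_mem_good_localGibbsLaw σ a₀ θ₀ u₀ N (Φ N)] with z hz
        exact (ofReal_sum_tagAct_le hσ.le Θ y K (Φ N) hτ.le s hz).trans (mul_le_mul' le_rfl (hdom z hz))
    _ = c₁ * ∫⁻ z, g z ∂P := lintegral_const_mul c₁ hgm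
    _ ≤ c₁ * L := mul_le_mul' le_rfl (hint.trans hlim)
    _ = Z * 2⁻¹ ^ K := hconst
    _ ≤ ENNReal.ofReal η := hK

end Assembly

/-! ## The registered stub -/

/-- **STUB 5, TAGGED HALF (T)** — `stub_taggedFromLabelEnvelope : LabelEnvelopeFromEnvelope → TaggedFromEnvelope`, with
`κ₅ = 1/200` and `σ₅ = 1/2`: the label-set envelope of the plumbing hypothesis feeds `taggedSmallOn_of_labelEnvelopeOn`. -/
theorem stub_taggedFromLabelEnvelope : LabelEnvelopeFromEnvelope → TaggedFromEnvelope := by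
  intro hL a₀ θ₀ u₀ ha hθ hu ha0 hθ0
  refine ⟨1 / 200, by norm_num, 1 / 2, by norm_num, fun σ hσ hσ5 Φ t t₁ β C ht htt₁ hβ hC hdil hE => ?_⟩
  have hLE := (hL a₀ θ₀ u₀ ha hθ hu ha0 hθ0 σ hσ (by linarith) Φ t₁ β C hC hE).1
  exact taggedSmallOn_of_labelEnvelopeOn hσ hσ5.le ha hθ hu ha0 hθ0 ht htt₁ hβ hC hdil hLE

end Summit.AtomisticToContinuum.HydrodynamicLimit.Theorems.CollisionActivityTailsAbnormalActivityTagged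

end
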